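import Summits.QuantumAdvantage.QuantumAdvantage.Theorems.ParityDialA

/-! # ParityDial (B) — decomp-qadv lens-2 g27, part 2/2 (mechanical split of the node file `g27/ParityDial.lean` at the §2/§3 boundary;
content verbatim).  Content: §3 family B (`xB`/`vB`/`σB`, `xB_parityUniversalHard`: `n ≡ 2 mod 4`, `n ≥ 22`); §4 `parityUniversalHard_one_all`
(every even `n ≥ 22`); §5 the class `IsParityLocal`, `not_rel_of_isParityLocal`, the pieces `PLocalFail` (★ `pLocalFail_one_seven` PROVED) /
`PGlobalFail` / `LightFailOdd`, the gluing `lightFail_of_pieces`, exactness `pieces_of_lightFail`, the node `lightFail_iff_pieces`, and `closes` /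
`closes_const` (→ `ExactnessDial.NoPerfectTwo3` / `NoPerfectConst3` BY NAME via `LightDial.closes`); §6 `predW_isParityLocal` (the g26
survivor `LightDial.predW` IS parity-local of radius 1), `not_predWPerfect_seven`, `not_pLocalFail_one_five` (the special threshold is EXACTLY 7,
via tree `LightDial.predWPerfect_five`).  See part A for the memo. -/

set_option linter.dupNamespace false
set_option linter.style.longLine false

noncomputable section
open scoped Classical

namespace Summit.QuantumAdvantage.QuantumAdvantage.Theorems.ParityDial
open Finset
open Literature.Computability.QuantumComplexity Literature.Computability.QuantumComplexity.RingHLF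
open Literature.Computability.MetaComplexity Literature.Computability.MetaComplexity.Smolensky
open Summit.QuantumAdvantage.AdviceFreeQNC0 (OddZeros)
open Summit.QuantumAdvantage.AdviceFreeQNC0.LightConeWindowHard
  (window window_apply dot2_eq_zero_of_pairing nxt_val prv_val xor3_eq_false_iff UniversalHard)
open Summit.QuantumAdvantage.QuantumAdvantage.Theorems.LightDial (wt wt_le_of_val_mem lightLosing LightFail)
open Summit.QuantumAdvantage.QuantumAdvantage.Theses.ExactnessDial (NoPerfectTwo3 NoPerfectConst3)

variable {n : ℕ}

/-! ## §3 Family B (`n ≡ 2 mod 4`, `n ≥ 22`): ones `{1,3,6,8,11,14,19}`; kernel support = all but `{2,7,12,14,16,18}`; sign bit 1;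
pairing = 8 table pairs on `[0,22)` + blocks of four on `[22, n)`. -/

/-- family B: the input with ones at `{1, 3, 6, 8, 11, 14, 19}` (weight 7), any length `n`. -/
def xB (n : ℕ) : Fin n → Bool := fun j => decide ((j : ℕ) = 1 ∨ (j : ℕ) = 3 ∨ (j : ℕ) = 6 ∨ (j : ℕ) = 8 ∨ (j : ℕ) = 11 ∨ (j : ℕ) = 14 ∨ (j : ℕ) = 19)
/-- its kernel support: every position except `{2, 7, 12, 14, 16, 18}` (for `n ≡ 2 (mod 4)`, `n ≥ 22`). -/
abbrev VB (t : ℕ) : Prop := t ≠ 2 ∧ t ≠ 7 ∧ t ≠ 12 ∧ t ≠ 14 ∧ t ≠ 16 ∧ t ≠ 18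
/-- ParityDial helper `vB`: the kernel vector of `xB` as a Boolean function. -/
def vB (n : ℕ) : Fin n → Bool := fun b => decide (VB b)
/-- the pairing of `supp vB`: a table on `[0, 22)` (8 pairs of equal parity and equal radius-1 window) and the
blocks `t ↦ t ± 2` on the far stretch `[22, n)` (all windows zero there). -/
def σBval (t : ℕ) : ℕ :=
  if 22 ≤ t then (if (t - 22) % 4 < 2 then t + 2 else t - 2)
  else if t = 0 then 10
  else if t = 1 then 3
  else if t = 3 then 1
  else if t = 4 then 20
  else if t = 5 then 13
  else if t = 6 then 8
  else if t = 8 then 6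
  else if t = 9 then 15
  else if t = 10 then 0
  else if t = 11 then 19
  else if t = 13 then 5
  else if t = 15 then 9
  else if t = 17 then 21
  else if t = 19 then 11
  else if t = 20 then 4
  else if t = 21 then 17
  else t
/-- ParityDial helper `σB`: the pairing as a map `Fin n → Fin n`. -/
def σB (n : ℕ) : Fin n → Fin n := fun b => ⟨min (σBval b) (n - 1), by have := b.isLt; omega⟩

/-- ParityDial helper `σB_val`: the value of the pairing on the support, as a case list. -/
theorem σB_val (hn : 22 ≤ n) (h4 : n % 4 = 2) (b : Fin n) (hb : vB n b = true) :
    ((b : ℕ) = 0 ∧ ((σB n b : Fin n) : ℕ) = 10) ∨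
    ((b : ℕ) = 1 ∧ ((σB n b : Fin n) : ℕ) = 3) ∨
    ((b : ℕ) = 3 ∧ ((σB n b : Fin n) : ℕ) = 1) ∨
    ((b : ℕ) = 4 ∧ ((σB n b : Fin n) : ℕ) = 20) ∨
    ((b : ℕ) = 5 ∧ ((σB n b : Fin n) : ℕ) = 13) ∨
    ((b : ℕ) = 6 ∧ ((σB n b : Fin n) : ℕ) = 8) ∨
    ((b : ℕ) = 8 ∧ ((σB n b : Fin n) : ℕ) = 6) ∨
    ((b : ℕ) = 9 ∧ ((σB n b : Fin n) : ℕ) = 15) ∨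
    ((b : ℕ) = 10 ∧ ((σB n b : Fin n) : ℕ) = 0) ∨
    ((b : ℕ) = 11 ∧ ((σB n b : Fin n) : ℕ) = 19) ∨
    ((b : ℕ) = 13 ∧ ((σB n b : Fin n) : ℕ) = 5) ∨
    ((b : ℕ) = 15 ∧ ((σB n b : Fin n) : ℕ) = 9) ∨
    ((b : ℕ) = 17 ∧ ((σB n b : Fin n) : ℕ) = 21) ∨
    ((b : ℕ) = 19 ∧ ((σB n b : Fin n) : ℕ) = 11) ∨
    ((b : ℕ) = 20 ∧ ((σB n b : Fin n) : ℕ) = 4) ∨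
    ((b : ℕ) = 21 ∧ ((σB n b : Fin n) : ℕ) = 17) ∨
    (22 ≤ (b : ℕ) ∧ ((b : ℕ) - 22) % 4 < 2 ∧ ((σB n b : Fin n) : ℕ) = (b : ℕ) + 2) ∨
    (22 ≤ (b : ℕ) ∧ 2 ≤ ((b : ℕ) - 22) % 4 ∧ ((σB n b : Fin n) : ℕ) = (b : ℕ) - 2) := by
  have hlt := b.isLt
  simp only [vB, decide_eq_true_eq] at hb
  simp only [σB, Fin.val_mk]
  generalize hbt : (b : ℕ) = t at *
  by_cases hT : 22 ≤ t
  · have e : σBval t = if (t - 22) % 4 < 2 then t + 2 else t - 2 := by unfold σBval; rw [if_pos hT]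
    rw [e]
    split_ifs with hc
    · iterate 16 right
      left; exact ⟨hT, hc, by omega⟩
    · iterate 17 right
      exact ⟨hT, by omega, by omega⟩
  · interval_cases t <;> first | (exfalso; omega) | (simp [σBval] <;> omega)

/-- ParityDial helper `vB_σB`: the pairing preserves the support. -/
theorem vB_σB (hn : 22 ≤ n) (h4 : n % 4 = 2) (b : Fin n) (hb : vB n b = true) : vB n (σB n b) = true := by
  have h := σB_val hn h4 b hb
  have hb' : VB b := by simpa only [vB, decide_eq_true_eq] using hb
  simp only [vB, decide_eq_true_eq]
  rcases h with h | h | h | h | h | h | h | h | h | h | h | h | h | h | h | h | h | h <;> omega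

/-- ParityDial helper `par_σB`: the pairing preserves the position parity. -/
theorem par_σB (hn : 22 ≤ n) (h4 : n % 4 = 2) (b : Fin n) (hb : vB n b = true) : par (σB n b) = par b := by
  have h := σB_val hn h4 b hb
  simp only [par, decide_eq_decide]
  rcases h with h | h | h | h | h | h | h | h | h | h | h | h | h | h | h | h | h | h <;> omega

/-- ParityDial helper `σB_ne`: the pairing is fixed-point free on the support. -/
theorem σB_ne (hn : 22 ≤ n) (h4 : n % 4 = 2) (b : Fin n) (hb : vB n b = true) : σB n b ≠ b := by
  have h := σB_val hn h4 b hb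
  intro he
  have h' := congrArg Fin.val he
  rcases h with h | h | h | h | h | h | h | h | h | h | h | h | h | h | h | h | h | h <;> omega

/-- ParityDial helper `σB_σB`: the pairing is an involution on the support. -/
theorem σB_σB (hn : 22 ≤ n) (h4 : n % 4 = 2) (b : Fin n) (hb : vB n b = true) : σB n (σB n b) = b := by
  have h1 := σB_val hn h4 b hb
  have h2 := σB_val hn h4 (σB n b) (vB_σB hn h4 b hb)
  apply Fin.ext
  rcases h1 with h | h | h | h | h | h | h | h | h | h | h | h | h | h | h | h | h | h <;> omega

set_option maxHeartbeats 4000000 in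
/-- ParityDial helper `window_σB`: the pairing preserves the radius-1 window of `xB`. -/
theorem window_σB (hn : 22 ≤ n) (h4 : n % 4 = 2) (b : Fin n) (hb : vB n b = true) :
    window 1 (xB n) (σB n b) = window 1 (xB n) b := by
  have h := σB_val hn h4 b hb
  have hlt := b.isLt
  funext d
  have hd := d.isLt
  rw [window_apply 1 (by omega), window_apply 1 (by omega)]
  simp only [xB, decide_eq_decide]
  generalize hs : ((σB n b : Fin n) : ℕ) = s at *
  generalize hdd : (d : ℕ) = dd at *
  generalize ht : (b : ℕ) = t at *
  interval_cases dd <;>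
  · rcases h with ⟨rfl, rfl⟩ | ⟨rfl, rfl⟩ | ⟨rfl, rfl⟩ | ⟨rfl, rfl⟩ | ⟨rfl, rfl⟩ | ⟨rfl, rfl⟩ | ⟨rfl, rfl⟩ | ⟨rfl, rfl⟩ | ⟨rfl, rfl⟩ | ⟨rfl, rfl⟩ | ⟨rfl, rfl⟩ | ⟨rfl, rfl⟩ | ⟨rfl, rfl⟩ | ⟨rfl, rfl⟩ | ⟨rfl, rfl⟩ | ⟨rfl, rfl⟩ | ⟨hT, hm, rfl⟩ | ⟨hT, hm, rfl⟩
    all_goals (split_ifs <;> ((try simp) <;> omega))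

/-- ParityDial helper `inKernel_vB`: `vB` is a kernel vector of `xB` (`n ≥ 22`). -/
theorem inKernel_vB (hn : 22 ≤ n) : InKernel (xB n) (vB n) := by
  intro b
  rw [xor3_eq_false_iff]
  have hb := b.isLt
  simp only [vB, xB, Bool.and_eq_true, decide_eq_true_eq, ne_eq, decide_eq_decide, prv_val, nxt_val]
  split_ifs <;> omega

/-- ParityDial helper `edgesIn_vB`: the support has `n − 12` inner edges. -/
theorem edgesIn_vB (hn : 22 ≤ n) : edgesIn (vB n) = n - 12 := by
  unfold edgesIn
  have h : (univ.filter fun b : Fin n => vB n b = true ∧ vB n (nxt b) = true)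
      = univ \ ({1, 2, 6, 7, 11, 12, 13, 14, 15, 16, 17, 18} : Finset ℕ).attachFin (by
          intro t ht; simp only [mem_insert, mem_singleton] at ht; omega) := by
    ext b
    have hb := b.isLt
    simp only [mem_filter, mem_univ, true_and, mem_sdiff, mem_attachFin, vB, decide_eq_true_eq, nxt_val, mem_insert,
      mem_singleton]
    split_ifs <;> omega
  have hc : ({1, 2, 6, 7, 11, 12, 13, 14, 15, 16, 17, 18} : Finset ℕ).card = 12 := by rfl
  rw [h, card_sdiff_of_subset (subset_univ _), card_attachFin, card_univ, Fintype.card_fin, hc]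

/-- ParityDial helper `wtAnd_xB`: `6` ones of `xB` lie in the support. -/
theorem wtAnd_xB (hn : 22 ≤ n) : wtAnd (xB n) (vB n) = 6 := by
  unfold wtAnd
  have h : (univ.filter fun b : Fin n => xB n b = true ∧ vB n b = true)
      = ({1, 3, 6, 8, 11, 19} : Finset ℕ).attachFin (by intro t ht; simp only [mem_insert, mem_singleton] at ht; omega) := by
    ext b
    have hb := b.isLt
    simp only [mem_filter, mem_univ, true_and, mem_attachFin, vB, xB, decide_eq_true_eq, mem_insert, mem_singleton]
    omega
  have hc : ({1, 3, 6, 8, 11, 19} : Finset ℕ).card = 6 := by rfl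
  rw [h, card_attachFin, hc]

/-- ParityDial helper `signBit_xB`: the sign bit of the certificate is `1` (`n` even, `n ≥ 22`). -/
theorem signBit_xB (hn : 22 ≤ n) (h4 : n % 4 = 2) : signBit (xB n) (vB n) = 1 := by
  unfold signBit; rw [edgesIn_vB hn, wtAnd_xB hn]; omega

/-- ParityDial helper `card_zeros_xB`: `xB` has `n − 7` zeros. -/
theorem card_zeros_xB (hn : 22 ≤ n) : (univ.filter fun b : Fin n => xB n b = false).card = n - 7 := by
  have h : (univ.filter fun b : Fin n => xB n b = false)
      = univ \ ({1, 3, 6, 8, 11, 14, 19} : Finset ℕ).attachFin (by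
          intro t ht; simp only [mem_insert, mem_singleton] at ht; omega) := by
    ext b
    simp only [mem_filter, mem_univ, true_and, mem_sdiff, mem_attachFin, xB, decide_eq_false_iff_not, mem_insert,
      mem_singleton]
  have hc : ({1, 3, 6, 8, 11, 14, 19} : Finset ℕ).card = 7 := by rfl
  rw [h, card_sdiff_of_subset (subset_univ _), card_attachFin, card_univ, Fintype.card_fin, hc]

/-- ParityDial helper `oddZeros_xB`: `xB` lies in the odd class when `n` is even (`n ≥ 22`). -/
theorem oddZeros_xB (hn : 22 ≤ n) (h4 : n % 4 = 2) : OddZeros (xB n) := by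
  unfold OddZeros; rw [card_zeros_xB hn]; omega

/-- ParityDial helper `wt_xB`: `xB` is LIGHT — weight `≤ 7` (exactly 7 once `n ≥ 20`). -/
theorem wt_xB (n : ℕ) : wt (xB n) ≤ 7 :=
  wt_le_of_val_mem [1, 3, 6, 8, 11, 14, 19] fun j hj => by
    simp only [xB, decide_eq_true_eq] at hj
    simp only [List.mem_cons, List.not_mem_nil, or_false]
    omega

/-- ★ FAMILY B IS PARITY-UNIVERSAL-HARD: for every `n ≡ 2 (mod 4)`, `n ≥ 22`, the weight-7 input `xB n` defeats EVERY
parity-aware radius-1 rule (hence every such rule with any input-global advice, `parityUniversalHard_any_advice`). -/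
theorem xB_parityUniversalHard (hn : 22 ≤ n) (h4 : n % 4 = 2) : ParityUniversalHard 1 (xB n) :=
  parityUniversalHard_of_pairing 1 (xB n) (vB n) (σB n) (oddZeros_xB hn h4) (inKernel_vB hn)
    (signBit_xB hn h4) (vB_σB hn h4) (window_σB hn h4) (par_σB hn h4) (σB_ne hn h4) (σB_σB hn h4)

/-! ## §4 Every even length `n ≥ 22` carries a weight-7 parity-universal-hard input -/

/-- ★★ PARITY-UNIVERSAL HARDNESS AT RADIUS 1, ALL EVEN `n ≥ 22` (threshold sharp in the data: none of weight `≤ 7` exists for `n ≤ 20`,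
`g27/num/uhard_parity.py`). -/
theorem parityUniversalHard_one_all (n : ℕ) (hn : 22 ≤ n) (he : n % 2 = 0) :
    ∃ x : Fin n → Bool, wt x ≤ 7 ∧ ParityUniversalHard 1 x := by
  rcases Nat.lt_or_ge n 24 with h | h
  · exact ⟨xB n, wt_xB n, xB_parityUniversalHard (by omega) (by omega)⟩
  · by_cases h4 : n % 4 = 0
    · exact ⟨xA n, wt_xA n, xA_parityUniversalHard h h4⟩
    · exact ⟨xB n, wt_xB n, xB_parityUniversalHard (by omega) (by omega)⟩

/-! ## §5 The dial: parity-local (SPECIAL, closed here) vs global (GENERIC) rules; the node on `LightFail 2 7` -/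

/-- a strategy `P` (one `𝔽₃`-valued cube function per position; answer bit `[P i x = 1]`) is PARITY-LOCAL of radius `r`: on every
input, two positions of the same parity with the same radius-`r` window answer alike — i.e. `z_i = F(i mod 2, x|[i−r,i+r], a(x))` for some
rule table `F` and some input-global advice `a` (no degree hypothesis).  Contains the predecessor rule `predW`, its mirror, every comb rule
`c₀ + αE + βO + γEO + …` decorated with nearest-neighbour terms (`E_i`, `O_i` are functions of `i mod 2` and the global parity counts when `n`
is even). -/
def IsParityLocal (r : ℕ) (P : Fin n → CubeFn (ZMod 3) n) : Prop :=
  ∀ x : Fin n → Bool, ∀ i j : Fin n, par i = par j → window r x i = window r x j → (P i x = 1 ↔ P j x = 1)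

/-- a parity-local strategy factors through `plocStrat` on each input, so a parity-universal-hard input defeats it. -/
theorem not_rel_of_isParityLocal {r : ℕ} {P : Fin n → CubeFn (ZMod 3) n} (hP : IsParityLocal r P) {x : Fin n → Bool}
    (hx : ParityUniversalHard r x) : ¬ Rel x (fun i => decide (P i x = 1)) := by
  have key : (fun i => decide (P i x = 1)) = plocStrat r (fun p w =>
      if h : ∃ j : Fin n, par j = p ∧ window r x j = w then decide (P h.choose x = 1) else false) x := by
    funext i
    have h : ∃ j : Fin n, par j = par i ∧ window r x j = window r x i := ⟨i, rfl, rfl⟩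
    simp only [plocStrat, dif_pos h]
    obtain ⟨hp, hw⟩ := h.choose_spec
    rw [decide_eq_decide]
    exact (hP x _ _ hp hw).symm
  rw [key]
  exact hx.2 _

/-- SPECIAL PIECE `PLocalFail r w` (degree-free): eventually in EVEN `n`, every parity-local strategy of radius `r` loses on an odd-class
input of weight `≤ w`. -/
def PLocalFail (r w : ℕ) : Prop :=
  ∃ n₀ : ℕ, ∀ n ≥ n₀, n % 2 = 0 → ∀ P : Fin n → CubeFn (ZMod 3) n, IsParityLocal r P →
    ∃ x : Fin n → Bool, OddZeros x ∧ wt x ≤ w ∧ ¬ Rel x (fun i => decide (P i x = 1))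

/-- GENERIC PIECE `PGlobalFail r D w` (OPEN at `(1,2,7)`; carries the difficulty of `LightFail 2 7` on even lengths): eventually in EVEN
`n`, every degree-`≤ D` strategy that is NOT parity-local of radius `r` loses on an odd-class input of weight `≤ w`. -/
def PGlobalFail (r D w : ℕ) : Prop :=
  ∃ n₀ : ℕ, ∀ n ≥ n₀, n % 2 = 0 → ∀ P : Fin n → CubeFn (ZMod 3) n, (∀ i, P i ∈ lowDeg (ZMod 3) n D) → ¬ IsParityLocal r P →
    ∃ x : Fin n → Bool, OddZeros x ∧ wt x ≤ w ∧ ¬ Rel x (fun i => decide (P i x = 1))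

/-- ODD-LENGTH PIECE (untouched by this generation): eventually every ODD length lies in `lightLosing D w`. -/
def LightFailOdd (D w : ℕ) : Prop := ∃ n₀ : ℕ, ∀ n ≥ n₀, n % 2 = 1 → n ∈ lightLosing D w

/-- ★★ THE SPECIAL PIECE IS A THEOREM at radius 1, weight 7 (and for every degree). -/
theorem pLocalFail_one_seven : PLocalFail 1 7 := by
  refine ⟨22, fun n hn he P hP => ?_⟩
  obtain ⟨x, hw, hx⟩ := parityUniversalHard_one_all n hn he
  exact ⟨x, hx.1, hw, not_rel_of_isParityLocal hP hx⟩

/-- monotonicity of the special piece in the weight. -/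
theorem pLocalFail_mono {r w w' : ℕ} (hw : w ≤ w') (h : PLocalFail r w) : PLocalFail r w' := by
  obtain ⟨n₀, h₀⟩ := h
  refine ⟨n₀, fun n hn he P hP => ?_⟩
  obtain ⟨x, hx, hxw, hR⟩ := h₀ n hn he P hP
  exact ⟨x, hx, hxw.trans hw, hR⟩

/-- GLUING: special + generic (even lengths) + the odd lengths give the light dial statement. -/
theorem lightFail_of_pieces {r D w : ℕ} (hs : PLocalFail r w) (hg : PGlobalFail r D w) (ho : LightFailOdd D w) : LightFail D w := by
  obtain ⟨n₁, h₁⟩ := hs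
  obtain ⟨n₂, h₂⟩ := hg
  obtain ⟨n₃, h₃⟩ := ho
  refine ⟨n₁ + n₂ + n₃, fun n hn P hP => ?_⟩
  rcases Nat.mod_two_eq_zero_or_one n with he | hodd
  · by_cases hl : IsParityLocal r P
    · exact h₁ n (by omega) he P hl
    · exact h₂ n (by omega) he P hP hl
  · exact h₃ n (by omega) hodd P hP

/-- EXACTNESS: the light dial statement gives back the generic and the odd piece (the special piece is a theorem anyway). -/
theorem pieces_of_lightFail {r D w : ℕ} (h : LightFail D w) : PGlobalFail r D w ∧ LightFailOdd D w := by
  obtain ⟨n₀, h₀⟩ := h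
  exact ⟨⟨n₀, fun n hn _ P hP _ => h₀ n hn P hP⟩, ⟨n₀, fun n hn _ => h₀ n hn⟩⟩

/-- ★ NODE (EQUIV, every degree `D`): `LightFail D 7 ⟺ PGlobalFail 1 D 7 ∧ LightFailOdd D 7` — at weight 7 the parity-local rules are
off the table for every `D`; what remains of the law-bet on even lengths is the GLOBAL (non-parity-local) quadratic strategies. -/
theorem lightFail_iff_pieces (D : ℕ) : LightFail D 7 ↔ PGlobalFail 1 D 7 ∧ LightFailOdd D 7 :=
  ⟨pieces_of_lightFail, fun h => lightFail_of_pieces pLocalFail_one_seven h.1 h.2⟩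

/-- ★ `closes`: the generic piece and the odd-length piece give ExactnessDial's `NoPerfectTwo3` (stmt-QuantumAdvantage-27432) BY NAME,
through `LightDial.closes 7`. -/
theorem closes (hg : PGlobalFail 1 2 7) (ho : LightFailOdd 2 7) : NoPerfectTwo3 :=
  LightDial.closes 7 (lightFail_of_pieces pLocalFail_one_seven hg ho)

/-- the same for the constant-degree rung `NoPerfectConst3` (stmt-QuantumAdvantage-27380): per degree, a radius-1 generic piece and an
odd piece at some weight `w ≥ 7` suffice. -/
theorem closes_const (h : ∀ D : ℕ, ∃ w : ℕ, 7 ≤ w ∧ PGlobalFail 1 D w ∧ LightFailOdd D w) : NoPerfectConst3 :=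
  LightDial.closes_const fun D => by
    obtain ⟨w, hw, hg, ho⟩ := h D
    exact ⟨w, lightFail_of_pieces (pLocalFail_mono hw pLocalFail_one_seven) hg ho⟩


/-! ## §6 The g26 survivor is SPECIAL: `predW` is parity-local of radius 1 -/

/-- the last entry of the radius-1 window is the successor bit. -/
theorem window_one_two (x : Fin n → Bool) (k : Fin n) : window 1 x k ⟨2, by omega⟩ = x (nxt k) := by
  have hk := k.isLt
  rw [window_apply 1 (by omega)]
  congr 1
  apply Fin.ext
  rw [nxt_val]
  simp only
  split_ifs <;> omega

/-- ★ the predecessor witness `predW = E + 2·E·O + 2·x_{i+1}` of LightDial (tree `LightDial.predW`, perfect on weight `≤ 5` at every even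
length `≥ 10`, `LightDial.predWPerfect_five`) IS parity-local of radius 1 — so the special class of this node contains the rule that
killed `LightFail 2 5`. -/
theorem predW_isParityLocal (n : ℕ) : IsParityLocal 1 (fun i : Fin n => LightDial.predW i) := by
  intro x i j hp hw
  have hpar : LightDial.par i = LightDial.par j := by
    simp only [par, decide_eq_decide] at hp
    unfold LightDial.par
    omega
  have hE : LightDial.ecnt i x = LightDial.ecnt j x := by unfold LightDial.ecnt; rw [hpar]
  have hO : LightDial.ocnt i x = LightDial.ocnt j x := by unfold LightDial.ocnt; rw [hpar]
  have hN : x (nxt i) = x (nxt j) := by rw [← window_one_two x i, ← window_one_two x j, hw]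
  show LightDial.predW i x = 1 ↔ LightDial.predW j x = 1
  simp only [LightDial.predW, hE, hO, hN]

/-- hence (second proof of the `w = 7` half of tree `LightDial.predW_not_perfect_seven`, here for even `n ≥ 22` and by the universal input
instead of the two-minority family): `predW` is not perfect on weight `≤ 7`. -/
theorem not_predWPerfect_seven (hn : 22 ≤ n) (he : n % 2 = 0) : ¬ LightDial.PredWPerfect n 7 := by
  intro h
  obtain ⟨x, hw, hx⟩ := parityUniversalHard_one_all n hn he
  exact not_rel_of_isParityLocal (predW_isParityLocal n) hx (h x hx.1 hw)

/-- ★ THE SPECIAL DIAL'S THRESHOLD IS EXACTLY 7: the parity-local piece FAILS at weight 5 (tree `LightDial.predWPerfect_five`: `predW` is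
perfect on weight `≤ 5` at every even length `≥ 3`, and `predW` is parity-local of radius 1) and HOLDS at weight 7 (`pLocalFail_one_seven`). -/
theorem not_pLocalFail_one_five : ¬ PLocalFail 1 5 := by
  rintro ⟨n₀, h₀⟩
  have he : (2 * (n₀ + 2)) % 2 = 0 := by omega
  obtain ⟨x, hx, hw, hR⟩ := h₀ (2 * (n₀ + 2)) (by omega) he (fun i => LightDial.predW i) (predW_isParityLocal _)
  exact hR (LightDial.predWPerfect_five ⟨n₀ + 2, by ring⟩ (by omega) x hx hw)

/-- no parity-universal-hard input of radius 1 has weight `≤ 5` (even `n ≥ 4`): the weight 7 of families A/B is forced. -/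
theorem not_parityUniversalHard_of_wt_le_five (he : n % 2 = 0) (h4 : 4 ≤ n) {x : Fin n → Bool} (hw : wt x ≤ 5) :
    ¬ ParityUniversalHard 1 x := fun hx =>
  not_rel_of_isParityLocal (predW_isParityLocal n) hx (LightDial.predWPerfect_five ⟨n / 2, by omega⟩ (by omega) x hx.1 hw)

end Summit.QuantumAdvantage.QuantumAdvantage.Theorems.ParityDial
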